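import Mathlib.Algebra.MvPolynomial.CommRing
import Mathlib.RingTheory.MvPolynomial.Basic
import Mathlib.Data.Complex.Basic
import Mathlib.Data.Fintype.Card
import Literature.Computability.AlgebraicComplexity.CircuitDepth
import HarnessLib

/-!
# Constant-depth algebraic circuits are closed under taking factors
# (Bhattacharjee–Kumar–Rai–Ramanathan–Saptharishi–Saraf 2025, Thm. 1), as a named fact

Topic `Literature/Computability/AlgebraicComplexity`. This file STATES (D-0014; no proof) the 2025
closure theorem of S. Bhattacharjee, M. Kumar, S. S. Rai, V. Ramanathan, R. Saptharishi and S. Saraf,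
*Closure under factorization from a result of Furstenberg*, arXiv:2506.23214, in the
(product-depth, wires) currency of `Literature.Computability.AlgebraicComplexity.ArithCircuit`
(`ArithCircuit.productDepth`, `ArithCircuit.edgeSize` of `CircuitDepth.lean`, the Limaye–Srinivasan–Tavenas
size measure), in exactly the form in which it is CONSUMED in the tree: it is, verbatim, the hypothesis
`hfac` of `Summit.ValiantsHypothesis.ValiantsHypothesis.Theorems.DefinabilityGapK1ConstDepthRung.kiPlantedHittingCD_of_cdFactorClosure`
(proposal p771224, decomp-valiant lens 5 generation 12), which derives from it the constant-depth rung
`K1cd` of the Kabanets–Impagliazzo planted hitting statement for the permanent. Honest framing: a 2025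
theorem recorded as a `Prop` with a locator; nothing here bears on `VP ≠ VNP`, which is NOT proved.

**The printed result** (corpus text `paper:arxiv-2506.23214`, p. 3 L21–30 and p. 4 L1–6 = §1.1,
Theorem 1 "Closure under factorization"): "Let 𝔽 be a field of characteristic zero, f be a polynomial on
n variables of degree d over 𝔽 and g be a factor of f. Then, the following are true. If f can be
computed by an algebraic circuit of size s and depth Δ over 𝔽, then g can be computed by an algebraic
circuit of size poly(s, d, n) and depth Δ + O(1) over 𝔽. If f can be computed by an algebraic formula
of size s over 𝔽, then g can be computed by an algebraic formula of size poly(s, d, n) over 𝔽."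
(Remark 2: also over fields of sufficiently large characteristic depending on d; Theorem 3 is the weaker
positive-characteristic version for g^{p^ℓ}.)

**Rendering (the special case the tree has language for).** Field: `ℂ` (a field of characteristic
zero). Depth: the tree measures unbounded-fan-in circuits by PRODUCT-DEPTH (number of product layers,
LST 2021 §1) and by EDGE SIZE (number of wires, LST 2021 §2); a depth-Δ circuit in the paper's sense has
product-depth ≤ Δ, and a product-depth-Δ circuit is a depth-O(Δ) circuit of polynomially related size
after merging consecutive sum (resp. product) layers, so "depth Δ ↦ depth Δ + O(1), size s ↦ poly(s,d,n)"
becomes "product-depth ≤ Δ ↦ product-depth ≤ Δ′, wires ↦ ≤ (wires + deg f + n + 2)^a" for SOME Δ′ and a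
depending only on Δ. This is the printed circuit statement OR WEAKER: Δ′ is left free instead of
Δ + O(1), and the exponent a of the polynomial bound is allowed to depend on Δ (the critic of the
decomp-valiant cell, bus line 688, checked this reading against the print). The formula half of
Theorem 1 and the positive-characteristic Theorem 3 are not stated here.
**Uniform rendering** (`BhattacharjeeEtAl2025_thm1_uniform`, added 2026-08-30). Theorem 1 = Theorem 29
(p. 12 L51–53) is stated for a circuit of ARBITRARY depth `Δ` with output "size poly(s,d,n) and depth
Δ + O(1)": the polynomial and the `O(1)` do not take `Δ` as an argument, and the proof (p. 12 L56–59,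
p. 13 L3–25: squarefree part by Andrews–Wigderson, a valid pre-processing substitution below the input
circuit, truncated power-series roots Theorem 27 (p. 12 L9–13, "depth(C') ≤ depth(C) + O(1)"), elementary
symmetric functions of the roots Lemma 28, interpolation Cor. 10 (p. 8 L56: "all the above operations yield
a circuit of size poly(s,d) and depth Δ + O(1)")) places FIXED constant-depth gadgets above and below the
input circuit; p. 13 L25 lists VP circuits, ABPs, formulas and constant-depth circuits as closed by this one
theorem. Hence the additive depth constant and the polynomial are ABSOLUTE, and the uniform form below puts
`∃ c₀ a` OUTSIDE `∀ Δ` (the decomp-valiant critic print-checked and endorsed this reading, bus line 705).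
CURRENCY CAVEAT (recorded, not hidden): the print's depth is the longest leaf-root path with constants on
edges (p. 8 L16), the tree's `productDepth` counts product gates on a path and carries constants as operands.
Passing between the two is the standard layering step — flatten maximal same-type chains (sum of sums, product
of products; wires `e ↦ ≤ e²`) so that a product-depth-`Δ` circuit becomes an alternating circuit of depth
`≤ 2Δ + 1`, apply the print (depth `≤ 2Δ + 1 + c`, size polynomial), re-flatten the output and push edge
constants into the adjacent product layer or a bottom scalar layer (wires squared at most), giving product-depth
`≤ Δ + ⌈(c + 1)/2⌉ + 1` and polynomially many wires: absolute constants again. So the uniform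
(product-depth, wires) form is the print plus this layering step; it implies the non-uniform form (take `Δ' := Δ + c₀`; proved
summit-side next to its consumer, `DefinabilityGapK1Log3OfBKRRSS25.bkrrss25_thm1_of_uniform`).
-- TODO(general form): arbitrary field of characteristic 0 (or > some bound in d); the formula statement;
-- Theorem 3 over 𝔽_q for g^{p^ℓ}; an in-tree proof of the layering step (product-depth ↔ depth currency).

**Use.** `(h : BhattacharjeeEtAl2025_thm1)` discharges the hypothesis of
`DefinabilityGapK1ConstDepthRung.kiPlantedHittingCD_of_cdFactorClosure` literally (same binder types,
same order), turning the lens-5 rung "K1 restricted to constant product-depth, every Δ and every size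
exponent b" into a theorem modulo this one named fact. `(h : BhattacharjeeEtAl2025_thm1_uniform)`, after
`obtain ⟨c₀, a, hfac⟩ := h`, discharges the hypothesis `hfac` of
`DefinabilityGapK1DepthLadder.k1AtDepth_log3_of_uniformFactorClosure` (p773541) literally, turning the
GROWING rung "K1 for annihilators of product-depth ⌊σ · log₂log₂log₂ m⌋, every σ ≤ 18/25" into a theorem
modulo this one named fact.

## References

* [BhattacharjeeEtAl2025] S. Bhattacharjee, M. Kumar, S. S. Rai, V. Ramanathan, R. Saptharishi,
  S. Saraf, *Closure under factorization from a result of Furstenberg*, arXiv:2506.23214 (2025), §1.1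
  Thm. 1 (p. 3–4), Remark 2, Thm. 3; Thm. 37 (p. 17, the hardness-to-hitting application).
* [LimayeSrinivasanTavenas2021] N. Limaye, S. Srinivasan, S. Tavenas, FOCS 2021, §1–2 (product-depth,
  size = wires).
-/

noncomputable section

open MvPolynomial

namespace Literature.Computability.AlgebraicComplexity

/-- **Bhattacharjee–Kumar–Rai–Ramanathan–Saptharishi–Saraf 2025, Theorem 1 (constant-depth circuits
are closed under factorization), (product-depth, wires) form over `ℂ`.** "If f can be computed by an
algebraic circuit of size s and depth Δ over 𝔽 [char 0], then [any factor] g can be computed by an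
algebraic circuit of size poly(s, d, n) and depth Δ + O(1) over 𝔽." Rendered: for every product-depth
bound `Δ` there are `Δ'` and an exponent `a` such that for every finite variable type `σ`, every nonzero
`P : MvPolynomial σ ℂ` computed by a circuit `Γ` of product-depth `≤ Δ`, and every divisor `Q ∣ P`, some
circuit `Γ'` computes `Q` with product-depth `≤ Δ'` and at most
`(Γ.edgeSize + P.totalDegree + Fintype.card σ + 2) ^ a` wires — the printed statement or weaker (`Δ'`
free instead of `Δ + O(1)`; `a` may depend on `Δ`). Verbatim the hypothesis `hfac` of
`DefinabilityGapK1ConstDepthRung.kiPlantedHittingCD_of_cdFactorClosure`. [cite: BhattacharjeeEtAl2025, Thm. 1] -/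
def BhattacharjeeEtAl2025_thm1 : Prop :=
  ∀ Δ : ℕ, ∃ Δ' a : ℕ, ∀ (σ : Type) [Fintype σ] [DecidableEq σ] (P Q : MvPolynomial σ ℂ)
    (Γ : ArithCircuit ℂ σ), Γ.Computes P → Γ.productDepth ≤ Δ → P ≠ 0 → Q ∣ P →
    ∃ Γ' : ArithCircuit ℂ σ, Γ'.Computes Q ∧ Γ'.productDepth ≤ Δ' ∧
      Γ'.edgeSize ≤ (Γ.edgeSize + P.totalDegree + Fintype.card σ + 2) ^ a

/-- **Bhattacharjee–Kumar–Rai–Ramanathan–Saptharishi–Saraf 2025, Theorem 1 = Theorem 29 (p. 12), UNIFORM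
(product-depth, wires) form over `ℂ`: the additive depth overhead and the polynomial size bound are ABSOLUTE.**
"Let P be a polynomial on n variables of degree d computed by a circuit C of size s and depth Δ. Then any
factor g of P is computable by a circuit of size poly(s, d, n) and depth Δ + O(1)" — stated for arbitrary
`Δ`, with `poly` and `O(1)` independent of `Δ` (fixed Andrews–Wigderson / power-series-root gadgets around the
input circuit, Thm. 27, Lemma 28, Cor. 10). Rendered: there are ABSOLUTE `c₀ a : ℕ` such that for every
product-depth bound `Δ`, every finite variable type `σ`, every nonzero `P` computed by a circuit `Γ` of
product-depth `≤ Δ` and every divisor `Q ∣ P`, some circuit computes `Q` with product-depth `≤ Δ + c₀` and at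
most `(Γ.edgeSize + P.totalDegree + Fintype.card σ + 2) ^ a` wires. This is the print plus the standard
layering step between the print's depth (longest path, constants on edges) and the tree's product-depth
(constants as operands) described in the module docstring (`c₀ ≤ ⌈(c+1)/2⌉ + 1` for the print's `O(1) = c`).
After `obtain ⟨c₀, a, hfac⟩`, `hfac` is verbatim the hypothesis of
`DefinabilityGapK1DepthLadder.k1AtDepth_log3_of_uniformFactorClosure`.
[cite: BhattacharjeeEtAl2025, Thm. 1, Thm. 29] -/
def BhattacharjeeEtAl2025_thm1_uniform : Prop :=
  ∃ c₀ a : ℕ, ∀ (Δ : ℕ) (σ : Type) [Fintype σ] [DecidableEq σ] (P Q : MvPolynomial σ ℂ)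
    (Γ : ArithCircuit ℂ σ), Γ.Computes P → Γ.productDepth ≤ Δ → P ≠ 0 → Q ∣ P →
    ∃ Γ' : ArithCircuit ℂ σ, Γ'.Computes Q ∧ Γ'.productDepth ≤ Δ + c₀ ∧
      Γ'.edgeSize ≤ (Γ.edgeSize + P.totalDegree + Fintype.card σ + 2) ^ a

end Literature.Computability.AlgebraicComplexity

end
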